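import Mathlib
import HarnessLib
import Literature.MathematicalPhysics.QuantumFieldTheory.ConstructiveQFTWave0
import Literature.MathematicalPhysics.QuantumLattice.GaugeGroups
import Literature.MathematicalPhysics.QuantumLattice.GaugeGroupsProofs
import Literature.LinearAlgebra.Matrix.UnitaryGramSchmidtRetraction
import Summits.Ventures.LatticeQCDFlow.Scaling.SparsePatchSectors
import Summits.Ventures.LatticeQCDFlow.Scaling.SparsePatchSectorsLattice
import Summits.Ventures.LatticeQCDFlow.Scaling.SparsePatchSectorsLatticeGroups
import Summits.Ventures.LatticeQCDFlow.Scaling.ExposedPatchSectors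
import Summits.Ventures.LatticeQCDFlow.Scaling.ExposedPatchSectorsLattice
import Summits.Ventures.LatticeQCDFlow.Scaling.GaugeFixedPatchSectors

/-!
# LatticeQCDFlow / Scaling — the GAUGE-FIXED PEELABLE-PATCH tunnelling law on the lattice for `SU(N)` and `U(N)` (v3.3, item 86b)

HONEST FRAMING: exact (Metropolis-corrected) sampling algorithms for lattice gauge theory; figures
of merit are autocorrelation/cost numbers at stated couplings and volumes; no continuum-physics
claim.

THEORY-2.md §3.3 / conjecture C7(b′), THIRD STEP, lattice part (abstract law:
`Scaling/GaugeFixedPatchSectors.lean`):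

* `dist_plaqSlot_le_add_sum` — on the lattice every slot of every plaquette is read off, up to the
  displacement of the OTHER slots, by the plaquette:
  `dist (U_e, V_e) ≤ dist (U_p, 1) + dist (V_p, 1) + Σ_{other slots} dist (U_{e'}, V_{e'})` (bi-invariant
  metric, `L ≥ 2`);
* a gauge transformation conjugates every plaquette (inlined in `dist_plaquetteHolonomy_gaugeTransform_one`;
  LANDING NOTE lean-1 GEN-5: the stand-alone lemma was dropped as a near-duplicate of a YangMills tree lemma), so it
  preserves every Wilson defect (`dist_plaquetteHolonomy_gaugeTransform_one`) and — the gauge group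
  `G^{sites}` being connected — it never leaves the sector (`gaugeTransform_mem_connectedComponentIn`);
* THE LAW **`Lattice.compProd_sector_ne_le_of_gaugePeelable`** (generic `G`);
  **`SUN.compProd_sector_ne_le_of_gaugePeelable`** (`∃ r₀(N) > 0 ∀ 0 ≤ c, W ≥ 1, W·c ≤ r₀, (1 + 4W)·c ≤ ε`);
  **`UN.compProd_sector_ne_le_of_gaugePeelable`** (explicit `W·c ≤ 1/8`, `(1 + 8W)·c ≤ ε`): for every
  update set `Λ`, every `Λ' ⊆ Λ` such that every pair `(U, V)` agreeing off `Λ` admits a gauge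
  transformation `g` with `V^g = U` off `Λ'`, and every peel certificate `(rk, w ≤ W)` of `Λ'`: every
  `μ`-invariant Markov kernel moving only `Λ` satisfies
  `(μ ⊗ₘ κ){sector_ε ≠ sector_ε'} ≤ 2·μ{∃ p touching Λ, dist (U_p, 1) ≥ c}`.

So the law for a block update is reduced to a FINITE COMBINATORIAL CERTIFICATE of the block shape — a
gauge tree plus a peeling rank (for the solid box: `Scaling/BoxPeel.lean`, `Scaling/BoxPatchSectors.lean`).
NOT covered by the method: update sets containing every link crossing a hyperplane of the torus (a
centre twist is an exact move there, linkwise far from the identity modulo interior gauge).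
No sorry, no new axioms, no `def`.
-/

noncomputable section

open scoped Matrix.Norms.Frobenius ENNReal ProbabilityTheory
open MeasureTheory ProbabilityTheory Metric Set
open Literature.MathematicalPhysics.QuantumFieldTheory

/-! ## §1. The lattice: Lipschitz slot detection, gauge invariance of defects and sectors, the reduction -/

namespace Summit.Ventures.LatticeQCDFlow.Theory2.Lattice

variable {d L : ℕ}

section Generic

variable {G : Type*} [Group G] [PseudoMetricSpace G]

/-- **Every slot is read off up to the other slots** (`L ≥ 2`, bi-invariant metric):
`dist (U_e, V_e) ≤ dist (U_p, 1) + dist (V_p, 1) + Σ_{s' ≠ s} dist (U_{slot s'}, V_{slot s'})`. [folklore] -/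
theorem dist_plaqSlot_le_add_sum [NeZero L] (hL : 2 ≤ L)
    (hl : ∀ a b c : G, dist (a * b) (a * c) = dist b c) (hr : ∀ a b c : G, dist (a * c) (b * c) = dist a b)
    (p : Plaquette d L) (s : Fin 4) (U V : GaugeConfig d L G) :
    dist (U (plaqSlot p s)) (V (plaqSlot p s)) ≤ dist (plaquetteHolonomy U p.1 p.2.1.1 p.2.1.2) 1 +
      dist (plaquetteHolonomy V p.1 p.2.1.1 p.2.1.2) 1 +
      ∑ s' ∈ Finset.univ.erase s, dist (U (plaqSlot p s')) (V (plaqSlot p s')) := by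
  classical
  -- the hybrid: `V` on the slot `s`, `U` elsewhere
  set V'' : GaugeConfig d L G := fun e => if e = plaqSlot p s then V e else U e with hV''
  have hinj := plaqSlot_injective hL p
  have hoff : ∀ s', s' ≠ s → U (plaqSlot p s') = V'' (plaqSlot p s') := by
    intro s' hs'
    have hne : plaqSlot p s' ≠ plaqSlot p s := fun h => hs' (hinj h)
    show U (plaqSlot p s') = if plaqSlot p s' = plaqSlot p s then V (plaqSlot p s') else U (plaqSlot p s')
    rw [if_neg hne]
  have hon : V'' (plaqSlot p s) = V (plaqSlot p s) := by
    show (if plaqSlot p s = plaqSlot p s then V (plaqSlot p s) else U (plaqSlot p s)) = V (plaqSlot p s)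
    rw [if_pos rfl]
  have h1 := dist_plaqSlot_le_of_eq_off_slot hl hr p s U V'' hoff
  rw [hon] at h1
  have h2 := dist_plaquetteHolonomy_one_le hl hr p V V''
  have hsum : ∑ s', dist (V (plaqSlot p s')) (V'' (plaqSlot p s')) =
      ∑ s' ∈ Finset.univ.erase s, dist (U (plaqSlot p s')) (V (plaqSlot p s')) := by
    have h := Finset.add_sum_erase Finset.univ (fun s' => dist (V (plaqSlot p s')) (V'' (plaqSlot p s')))
      (Finset.mem_univ s)
    simp only [hon, dist_self, zero_add] at h
    rw [← h]
    refine Finset.sum_congr rfl fun s' hs' => ?_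
    rw [← hoff s' (Finset.ne_of_mem_erase hs'), dist_comm]
  rw [hsum] at h2
  linarith

/-- **Gauge transformations preserve every Wilson defect** (bi-invariant metric). [folklore] -/
theorem dist_plaquetteHolonomy_gaugeTransform_one
    (hl : ∀ a b c : G, dist (a * b) (a * c) = dist b c) (hr : ∀ a b c : G, dist (a * c) (b * c) = dist a b)
    (g : Site d L → G) (U : GaugeConfig d L G) (x : Site d L) (i j : Fin d) :
    dist (plaquetteHolonomy (gaugeTransform g U) x i j) 1 = dist (plaquetteHolonomy U x i j) 1 := by
  -- the plaquette holonomy transforms by conjugation (inlined; the tree has this one-liner as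
  -- `Summit.QuantumFields.YangMills.….StrictRP.plaquetteHolonomy_gaugeTransform'`, not imported here)
  have hconj : plaquetteHolonomy (gaugeTransform g U) x i j = g x * plaquetteHolonomy U x i j * (g x)⁻¹ := by
    have hshift : ∀ (x : Site d L) (i j : Fin d), (x.shift i).shift j = (x.shift j).shift i :=
      fun x i j => by simp only [Site.shift, add_assoc, add_comm (Pi.single (M := fun _ => ZMod L) i 1)]
    simp only [plaquetteHolonomy, gaugeTransform, hshift x j i, mul_inv_rev, inv_inv]
    group
  rw [hconj]
  calc dist (g x * plaquetteHolonomy U x i j * (g x)⁻¹) 1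
      = dist (g x * plaquetteHolonomy U x i j * (g x)⁻¹) (g x * 1 * (g x)⁻¹) := by
        rw [mul_one, mul_inv_cancel]
    _ = dist (plaquetteHolonomy U x i j) 1 := by rw [hr, hl]

omit [PseudoMetricSpace G] in
/-- The trivial gauge transformation. [folklore] -/
theorem gaugeTransform_one (U : GaugeConfig d L G) : gaugeTransform (1 : Site d L → G) U = U := by
  funext e
  simp only [gaugeTransform, Pi.one_apply, one_mul, inv_one, mul_one]

/-- The gauge orbit map `g ↦ U^g` is continuous. [folklore] -/
theorem continuous_gaugeTransform_left [ContinuousMul G] [ContinuousInv G] (U : GaugeConfig d L G) :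
    Continuous fun g : Site d L → G => gaugeTransform g U := by
  refine continuous_pi fun e => ?_
  show Continuous fun g : Site d L → G => g e.1 * U e * (g (e.1.shift e.2))⁻¹
  exact ((continuous_apply e.1).mul continuous_const).mul (continuous_apply _).inv

/-- **Gauge transformations never leave the sector** (connected structure group): if `V` is
`ε`-admissible then `V^g` lies in the connected component of `V` in the admissible set. [folklore] -/
theorem gaugeTransform_mem_connectedComponentIn [ContinuousMul G] [ContinuousInv G] [PreconnectedSpace G]
    (hl : ∀ a b c : G, dist (a * b) (a * c) = dist b c) (hr : ∀ a b c : G, dist (a * c) (b * c) = dist a b)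
    (g : Site d L → G) {ε : ℝ} {V : GaugeConfig d L G}
    (hV : ∀ p : Plaquette d L, dist (plaquetteHolonomy V p.1 p.2.1.1 p.2.1.2) 1 < ε) :
    gaugeTransform g V ∈ connectedComponentIn
      {W : GaugeConfig d L G | ∀ p : Plaquette d L, dist (plaquetteHolonomy W p.1 p.2.1.1 p.2.1.2) 1 < ε} V := by
  have hrange : IsPreconnected (range fun h : Site d L → G => gaugeTransform h V) :=
    isPreconnected_range (continuous_gaugeTransform_left V)
  have hsub : (range fun h : Site d L → G => gaugeTransform h V) ⊆
      {W : GaugeConfig d L G | ∀ p : Plaquette d L, dist (plaquetteHolonomy W p.1 p.2.1.1 p.2.1.2) 1 < ε} := by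
    rintro _ ⟨h, rfl⟩ p
    show dist (plaquetteHolonomy (gaugeTransform h V) p.1 p.2.1.1 p.2.1.2) 1 < ε
    rw [dist_plaquetteHolonomy_gaugeTransform_one hl hr]
    exact hV p
  have hmem : V ∈ range fun h : Site d L → G => gaugeTransform h V := ⟨1, gaugeTransform_one V⟩
  exact hrange.subset_connectedComponentIn hmem hsub ⟨g, rfl⟩

end Generic

section GenericLaws

variable {G : Type*} [Group G] [PseudoMetricSpace G] [MeasurableSpace G]

/-- **Gauge-fixed peelable tunnelling law on the lattice** (generic `G`: bi-invariant metric, continuous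
group operations, connected, `(ρ, r)`-local paths; `L ≥ 2`; thresholds `0 ≤ c`, `W·c ≤ ρ`, `c + 4r ≤ ε`).
DATA: the update set `Λ`; a subset `Λ'` onto which every pair agreeing off `Λ` can be GAUGE FIXED
(`hgauge`); a PEEL CERTIFICATE `(rk, w ≤ W)` of `Λ'`.  CONCLUSION: every `μ`-invariant Markov kernel
moving only `Λ` satisfies `(μ ⊗ₘ κ){sector_ε ≠ sector_ε'} ≤ 2·μ{∃ p touching Λ, dist (U_p, 1) ≥ c}`.
[folklore] -/
theorem compProd_sector_ne_le_of_gaugePeelable [NeZero L] (hL : 2 ≤ L)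
    (hl : ∀ a b c : G, dist (a * b) (a * c) = dist b c) (hr : ∀ a b c : G, dist (a * c) (b * c) = dist a b)
    [ContinuousMul G] [ContinuousInv G] [PreconnectedSpace G]
    {ρ r : ℝ} (hr0 : 0 ≤ r)
    (hpath : ∀ g g' : G, dist g g' ≤ ρ → ∃ γ : ℝ → G, ContinuousOn γ (Icc (0 : ℝ) 1) ∧ γ 0 = g ∧
      γ 1 = g' ∧ ∀ t ∈ Icc (0 : ℝ) 1, dist (γ t) g ≤ r)
    {c ε W : ℝ} (hc : 0 ≤ c) (hcρ : W * c ≤ ρ) (hcr : c + 4 * r ≤ ε)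
    {Λ Λ' : Set (Edge d L)} (hΛ' : Λ' ⊆ Λ) {rk : Edge d L → ℕ} {w : Edge d L → ℝ}
    (hpeel : ∀ e ∈ Λ', ∃ (p : Plaquette d L) (s : Fin 4), plaqSlot p s = e ∧
      (∀ s', s' ≠ s → plaqSlot p s' ∈ Λ' → rk (plaqSlot p s') < rk e) ∧
      2 + ∑ s' ∈ Finset.univ.erase s, Λ'.indicator w (plaqSlot p s') ≤ w e)
    (hW : ∀ e ∈ Λ', w e ≤ W)
    (hgauge : ∀ U V : GaugeConfig d L G, (∀ e ∉ Λ, U e = V e) →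
      ∃ g : Site d L → G, ∀ e ∉ Λ', U e = gaugeTransform g V e)
    (μ : Measure (GaugeConfig d L G)) [SFinite μ]
    (κ : Kernel (GaugeConfig d L G) (GaugeConfig d L G)) [IsMarkovKernel κ] (hinv : κ.Invariant μ)
    (hmove : ∀ᵐ q ∂(μ ⊗ₘ κ), ∀ e ∉ Λ, q.1 e = q.2 e) :
    (μ ⊗ₘ κ) {q | connectedComponentIn
          {W : GaugeConfig d L G | ∀ p : Plaquette d L, dist (plaquetteHolonomy W p.1 p.2.1.1 p.2.1.2) 1 < ε} q.1 ≠
        connectedComponentIn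
          {W : GaugeConfig d L G | ∀ p : Plaquette d L, dist (plaquetteHolonomy W p.1 p.2.1.1 p.2.1.2) 1 < ε} q.2} ≤
      2 * μ {U | ∃ (p : Plaquette d L) (s : Fin 4), plaqSlot p s ∈ Λ ∧
        c ≤ dist (plaquetteHolonomy U p.1 p.2.1.1 p.2.1.2) 1} := by
  refine Tunnelling.compProd_sector_ne_le_of_fixablePatch
    (a := fun (p : Plaquette d L) (W : GaugeConfig d L G) => dist (plaquetteHolonomy W p.1 p.2.1.1 p.2.1.2) 1)
    (slot := plaqSlot) (dist_plaquetteHolonomy_one_le hl hr)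
    (fun p s U V => dist_plaqSlot_le_add_sum hL hl hr p s U V) hΛ' hpeel hW hr0 hpath hc hcρ
    (by rw [Fintype.card_fin, Nat.cast_ofNat]; exact hcr) (fun U V hUV => ?_) μ κ hinv hmove
  obtain ⟨g, hg⟩ := hgauge U V hUV
  exact ⟨gaugeTransform g V, hg, fun p => dist_plaquetteHolonomy_gaugeTransform_one hl hr g V _ _ _,
    fun hV => gaugeTransform_mem_connectedComponentIn hl hr g hV⟩

end GenericLaws

end Summit.Ventures.LatticeQCDFlow.Theory2.Lattice

/-! ## §2. `SU(N)` (`N ≥ 1`) and `U(N)` -/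

namespace Summit.Ventures.LatticeQCDFlow.Theory2.Lattice.SUN

open Summit.Ventures.LatticeQCDFlow.Theory2.Lattice

variable {N : ℕ}

/-- **`SU(N)` gauge-fixed peelable tunnelling law** (`N ≥ 1`): `∃ r₀ = r₀(N) > 0` such that for all
`0 ≤ c`, `1 ≤ W`, `W·c ≤ r₀`, `(1 + 4W)·c ≤ ε`, every `d`, `L ≥ 2`, every update set `Λ` gauge-fixable
onto a `Λ' ⊆ Λ` with a peel certificate of budget `W`, every s-finite `μ` and every `μ`-invariant Markov
kernel moving only `Λ`: `(μ ⊗ₘ κ){sector_ε ≠ sector_ε'} ≤ 2·μ{∃ p touching Λ, dist (U_p, 1) ≥ c}`.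
[folklore] -/
theorem compProd_sector_ne_le_of_gaugePeelable [NeZero N] : ∃ r₀ : ℝ, 0 < r₀ ∧ ∀ c ε W : ℝ, 0 ≤ c →
    1 ≤ W → W * c ≤ r₀ → (1 + 4 * W) * c ≤ ε → ∀ {d L : ℕ} [NeZero L], 2 ≤ L →
      ∀ {Λ Λ' : Set (Edge d L)}, Λ' ⊆ Λ → ∀ {rk : Edge d L → ℕ} {w : Edge d L → ℝ},
      (∀ e ∈ Λ', ∃ (p : Plaquette d L) (s : Fin 4), plaqSlot p s = e ∧
        (∀ s', s' ≠ s → plaqSlot p s' ∈ Λ' → rk (plaqSlot p s') < rk e) ∧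
        2 + ∑ s' ∈ Finset.univ.erase s, Λ'.indicator w (plaqSlot p s') ≤ w e) →
      (∀ e ∈ Λ', w e ≤ W) →
      (∀ U V : GaugeConfig d L (Matrix.specialUnitaryGroup (Fin N) ℂ), (∀ e ∉ Λ, U e = V e) →
        ∃ g : Site d L → Matrix.specialUnitaryGroup (Fin N) ℂ, ∀ e ∉ Λ', U e = gaugeTransform g V e) →
      ∀ (μ : Measure (GaugeConfig d L (Matrix.specialUnitaryGroup (Fin N) ℂ))) [SFinite μ]
        (κ : Kernel (GaugeConfig d L (Matrix.specialUnitaryGroup (Fin N) ℂ))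
          (GaugeConfig d L (Matrix.specialUnitaryGroup (Fin N) ℂ))) [IsMarkovKernel κ],
        κ.Invariant μ → (∀ᵐ q ∂(μ ⊗ₘ κ), ∀ e ∉ Λ, q.1 e = q.2 e) →
        (μ ⊗ₘ κ) {q | connectedComponentIn
              {W | ∀ p : Plaquette d L, dist (plaquetteHolonomy W p.1 p.2.1.1 p.2.1.2) 1 < ε} q.1 ≠
            connectedComponentIn
              {W | ∀ p : Plaquette d L, dist (plaquetteHolonomy W p.1 p.2.1.1 p.2.1.2) 1 < ε} q.2} ≤
          2 * μ {U | ∃ (p : Plaquette d L) (s : Fin 4), plaqSlot p s ∈ Λ ∧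
            c ≤ dist (plaquetteHolonomy U p.1 p.2.1.1 p.2.1.2) 1} := by
  haveI : Nonempty (Fin N) := ⟨0⟩
  -- the topological-group and connectedness instances, transported (by `rfl`) from the product
  -- topology on matrices to the topology of the Frobenius metric used in this file
  haveI : @ContinuousMul (Matrix.specialUnitaryGroup (Fin N) ℂ)
      (UniformSpace.toTopologicalSpace (self := PseudoMetricSpace.toUniformSpace)) _ :=
    inferInstanceAs (ContinuousMul (Matrix.specialUnitaryGroup (Fin N) ℂ))
  haveI : @ContinuousInv (Matrix.specialUnitaryGroup (Fin N) ℂ)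
      (UniformSpace.toTopologicalSpace (self := PseudoMetricSpace.toUniformSpace)) _ :=
    inferInstanceAs (ContinuousInv (Matrix.specialUnitaryGroup (Fin N) ℂ))
  haveI : @PreconnectedSpace (Matrix.specialUnitaryGroup (Fin N) ℂ)
      (UniformSpace.toTopologicalSpace (self := PseudoMetricSpace.toUniformSpace)) :=
    (Literature.MathematicalPhysics.QuantumLattice.connectedSpace_specialUnitaryGroup
      (n := Fin N)).toPreconnectedSpace
  obtain ⟨r₀, hr₀, hpath⟩ := exists_localPaths_radius (N := N)
  refine ⟨r₀, hr₀, fun c ε W hc0 hW1 hWc hcε d L _ hL Λ Λ' hΛ' rk w hpeel hW hgauge μ _ κ _ hinv hmove => ?_⟩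
  have hWc0 : 0 ≤ W * c := mul_nonneg (by linarith) hc0
  exact Lattice.compProd_sector_ne_le_of_gaugePeelable hL dist_mul_left dist_mul_right (r := W * c)
    hWc0 (hpath (W * c) hWc) hc0 (le_refl _) (by nlinarith) hΛ' hpeel hW hgauge μ κ hinv hmove

end Summit.Ventures.LatticeQCDFlow.Theory2.Lattice.SUN

namespace Summit.Ventures.LatticeQCDFlow.Theory2.Lattice.UN

open Summit.Ventures.LatticeQCDFlow.Theory2.Lattice
open Literature.MathematicalPhysics.QuantumFieldTheory.UnitaryCayley (𝔾)

variable {N : ℕ}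

/-- **`U(N)` gauge-fixed peelable tunnelling law with explicit thresholds**: `0 ≤ c`, `1 ≤ W`,
`W·c ≤ 1/8`, `(1 + 8W)·c ≤ ε` (Cayley-chart local paths of radii `(Wc, 2Wc)`). [folklore] -/
theorem compProd_sector_ne_le_of_gaugePeelable {c ε W : ℝ} (hc0 : 0 ≤ c) (hW1 : 1 ≤ W)
    (hWc : W * c ≤ 1 / 8) (hcε : (1 + 8 * W) * c ≤ ε) {d L : ℕ} [NeZero L] (hL : 2 ≤ L)
    {Λ Λ' : Set (Edge d L)} (hΛ' : Λ' ⊆ Λ) {rk : Edge d L → ℕ} {w : Edge d L → ℝ}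
    (hpeel : ∀ e ∈ Λ', ∃ (p : Plaquette d L) (s : Fin 4), plaqSlot p s = e ∧
      (∀ s', s' ≠ s → plaqSlot p s' ∈ Λ' → rk (plaqSlot p s') < rk e) ∧
      2 + ∑ s' ∈ Finset.univ.erase s, Λ'.indicator w (plaqSlot p s') ≤ w e)
    (hW : ∀ e ∈ Λ', w e ≤ W)
    (hgauge : ∀ U V : GaugeConfig d L (𝔾 N), (∀ e ∉ Λ, U e = V e) →
      ∃ g : Site d L → 𝔾 N, ∀ e ∉ Λ', U e = gaugeTransform g V e)
    (μ : Measure (GaugeConfig d L (𝔾 N))) [SFinite μ]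
    (κ : Kernel (GaugeConfig d L (𝔾 N)) (GaugeConfig d L (𝔾 N))) [IsMarkovKernel κ] (hinv : κ.Invariant μ)
    (hmove : ∀ᵐ q ∂(μ ⊗ₘ κ), ∀ e ∉ Λ, q.1 e = q.2 e) :
    (μ ⊗ₘ κ) {q | connectedComponentIn
          {W : GaugeConfig d L (𝔾 N) | ∀ p : Plaquette d L, dist (plaquetteHolonomy W p.1 p.2.1.1 p.2.1.2) 1 < ε} q.1 ≠
        connectedComponentIn
          {W : GaugeConfig d L (𝔾 N) | ∀ p : Plaquette d L, dist (plaquetteHolonomy W p.1 p.2.1.1 p.2.1.2) 1 < ε} q.2} ≤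
      2 * μ {U | ∃ (p : Plaquette d L) (s : Fin 4), plaqSlot p s ∈ Λ ∧
        c ≤ dist (plaquetteHolonomy U p.1 p.2.1.1 p.2.1.2) 1} := by
  -- instances transported (by `rfl`) from the product topology to the Frobenius-metric topology
  haveI : @ContinuousMul (𝔾 N) (UniformSpace.toTopologicalSpace (self := PseudoMetricSpace.toUniformSpace)) _ :=
    inferInstanceAs (ContinuousMul (𝔾 N))
  haveI : @ContinuousInv (𝔾 N) (UniformSpace.toTopologicalSpace (self := PseudoMetricSpace.toUniformSpace)) _ :=
    inferInstanceAs (ContinuousInv (𝔾 N))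
  haveI : @PreconnectedSpace (𝔾 N) (UniformSpace.toTopologicalSpace (self := PseudoMetricSpace.toUniformSpace)) :=
    inferInstanceAs (PreconnectedSpace (𝔾 N))
  have hWc0 : 0 ≤ W * c := mul_nonneg (by linarith) hc0
  exact Lattice.compProd_sector_ne_le_of_gaugePeelable hL dist_mul_left dist_mul_right (ρ := W * c)
    (r := 2 * (W * c)) (by positivity) (fun g g' h => exists_localPaths hWc0 hWc g g' h) hc0 (le_refl _)
    (by nlinarith) hΛ' hpeel hW hgauge μ κ hinv hmove

end Summit.Ventures.LatticeQCDFlow.Theory2.Lattice.UN
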